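import Summits.ABC.ABC.Theses.CubicResolventAllowance
import Summits.ABC.ABC.Theorems.CubicResolventAllowanceResolventDiscBounds
import Literature.NumberTheory.CubicFields.BinaryCubicForms
import Literature.NumberTheory.DiophantineGeometry.Conductor
import Literature.NumberTheory.EllipticCurves.PastenValuationProductMestreOesterleProofs
import HarnessLib

/-!
# Stub-ideation k=3 (FAMILY 3 — probe the extremes), gen 6 — `stub_realCubic` of `IndexSzpiro` (stmt-ABC-22740)

Gens 2–5 of this slot (same directory: `StubIdeas3SketchG2…G5.lean`) probed the FREE-PRIME extreme
(saturating cube family in `ℚ(ζ₇)⁺`, `T1–T3`; the `Mp` regime `LocalIndexSzpiroMp`; the Thue–Mahler shadow).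
Gen 6 probes the OPPOSITE extreme — all depth at a FIXED finite prime set `S`, free primes shallow — and finds
it is a THEOREM, with the stub's exponent `6 + ε` on the nose:

* §1 the dictionary in ONE line: `2⁸·Δ_min = I²·|d_K|` (`Keystone`; PROVED as `K5_exists_index_sq_eq` in
  `StubIdeas1G5Sketch.lean`, not importable on the farm, hence a named hypothesis here), so the stub is
  literally `I ≤ C_ε · N^{3+ε/2}` for the index `I = [𝓞_K : ℤ[η]]` of the 2-division order of the minimal model.
* §2 the analytic input: Mahler–Ridout in the form of Bugeaud–Evertse–Győry 2018, Thm 2.4(i)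
  (`[F(x,y)]_S ≪_{F,S,ε} |F(x,y)|^{2/3+ε}` for binary cubic forms at coprime arguments; `p`-adic Roth,
  INEFFECTIVE) = `BEG24Cubic`; read through Delone–Faddeev (`ind(a+uω+vθ) = |F_K(u,v)|`) and the bounded
  content of the minimal 2-division order it says: `I ≤ C(K,S,ε)·(S-free part of I)^{3+ε}` (`RidoutIndexBound`).
* §3 the free part: on the family `F_B(K,S) = {class-K curves with v_p(Δ_min) ≤ 2B for p ∉ S}` (arbitrary
  towers AT `S`) the `S`-free part of `I` divides `N^B` (H4, PROVED: `N` and `Δ_min` have the same primes).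
* §4 the rungs (PROVED from §1–§3): `Δ_min ≤ C(K,S,ε)·|d_K|·N^{B(6+ε)}` on `F_B(K,S)`; `B = 1` is the STUB'S
  OWN INEQUALITY with exponent `6 + ε` on the infinite family `F₁(K,S)` (free primes unbounded, so outside
  Shafarevich's finite regime `F₀ = {N supported on S}` of k1); with BEG Thm 2.5 (effective, exponent
  `1 − κ₃`) the same proof gives an EFFECTIVE `PolySzpiro(2B/κ₃)` on `F_B(K,S)`.
* §5 what separates the rung from the stub: (U) uniformity of the Ridout constant in `K` (and in
  `S ⊇ primes(6d_K)`) = uniform `p`-adic Roth for cubic irrationalities (abc-strength, open) — typed as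
  `UniformRidoutIndexBound`, which gives the stub on the whole depth-1 locus `⋃_K F₁(K, S₀(K))` (PROVED);
  (T) any control at free-prime depth `≥ 2` (Ridout gives `6B`, not `6`: k2's UR₁ / gen-5's `LocalIndexSzpiroMp`).
  The stub is NOT the conjunction "(U) ∧ (free part ≤ N^{1+ε})": `y² = x³ + p²x + p³` (`p ≥ 5`; `K = ℚ(θ)`,
  `θ³+θ+1 = 0`, `d_K = −31`, `Δ_min = 2⁴·31·p⁶`, `I = 2⁶p³`, `2·31·p² ∣ N ∣ 2⁸·31·p²`) has `S₀`-part `2⁶` and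
  free part `p³ > N^{1+ε}`, yet satisfies the stub's inequality with room to spare.

`lean check`: rc 0; sorries ONLY in the bodies of the proposed helpers H1 (`beg24Index_of_cubic`, M),
H2 (`minimalOrderContent`, M), H3 (`ridoutIndexBound_of`, S).  H4, the core bound, R_B, R₁ and the (U)-corollary
are PROVED.  Nothing here is uniform in `K`: the stub itself stays OPEN (5-gen × 3-ideator consensus, not re-derived).
-/

open Polynomial NumberField WeierstrassCurve Finset
open Literature.NumberTheory.CubicFields

namespace Summit.ABC.ABC.Cruxes.IndexSzpiro.StubIdeas3G6

/-! ## §0 The stub (verbatim) and the class predicate -/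

/-- The stub, verbatim (`line2-birth.lean`, `stub_realCubic`). -/
def StubRealCubic : Prop :=
  ∀ ε : ℝ, 0 < ε → ∃ C : ℝ, ∀ (W : WeierstrassCurve ℚ) [W.IsElliptic] (K : Type) [Field K] [NumberField K],
    Irreducible W.twoTorsionPolynomial.toPoly → Module.finrank ℚ K = 3 →
    (∃ θ : K, aeval θ W.twoTorsionPolynomial.toPoly = 0) → 0 < NumberField.discr K →
    (W.minimalDiscriminantNorm ℤ : ℝ) ≤ C * |(NumberField.discr K : ℝ)| * (W.conductorNorm ℤ : ℝ) ^ (6 + ε)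

/-- `InClass W K`: `K` is a cubic field generated by a root of the (irreducible) 2-division polynomial of `W`
(the stub's three structural hypotheses; the sign `0 < d_K` is NOT used anywhere below — the rung is sign-blind). -/
def InClass (W : WeierstrassCurve ℚ) (K : Type) [Field K] [NumberField K] : Prop :=
  Irreducible W.twoTorsionPolynomial.toPoly ∧ Module.finrank ℚ K = 3 ∧
    ∃ θ : K, aeval θ W.twoTorsionPolynomial.toPoly = 0

theorem stub_iff_inClass : StubRealCubic ↔
    ∀ ε : ℝ, 0 < ε → ∃ C : ℝ, ∀ (W : WeierstrassCurve ℚ) [W.IsElliptic] (K : Type) [Field K] [NumberField K],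
      InClass W K → 0 < NumberField.discr K →
      (W.minimalDiscriminantNorm ℤ : ℝ) ≤
        C * |(NumberField.discr K : ℝ)| * (W.conductorNorm ℤ : ℝ) ^ (6 + ε) := by
  unfold StubRealCubic InClass
  constructor
  · intro h ε hε
    obtain ⟨C, hC⟩ := h ε hε
    exact ⟨C, fun W _ K _ _ hcl hd => hC W K hcl.1 hcl.2.1 hcl.2.2 hd⟩
  · intro h ε hε
    obtain ⟨C, hC⟩ := h ε hε
    exact ⟨C, fun W _ K _ _ h1 h2 h3 hd => hC W K ⟨h1, h2, h3⟩ hd⟩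

/-! ## §1 The dictionary in one line: `2⁸ Δ_min = I² |d_K|` -/

/-- **Keystone** (`I` = index of the 2-division order `ℤ[η]` of the global minimal model in `𝓞_K`).
PROVED, kernel-checked, as `K5_exists_index_sq_eq` in `Cruxes/IndexSzpiro/StubIdeas1G5Sketch.lean`
(k1 gen 5; crux work-files are not importable on the farm, so it enters here BY NAME as a hypothesis;
support item P0 = land it under `Theorems/`). Consequence: the stub reads `I ≤ C'_ε · N^{3 + ε/2}`. -/
def Keystone : Prop :=
  ∀ (W : WeierstrassCurve ℚ) [W.IsElliptic] (K : Type) [Field K] [NumberField K], InClass W K →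
    ∃ I : ℕ, 0 < I ∧ 2 ^ 8 * W.minimalDiscriminantNorm ℤ = I ^ 2 * (NumberField.discr K).natAbs

/-- `Smooth S s`: every prime factor of `s` lies in `S`. -/
def Smooth (S : Finset ℕ) (s : ℕ) : Prop := ∀ p : ℕ, p.Prime → p ∣ s → p ∈ S

/-! ## §2 The analytic input: Mahler–Ridout / Bugeaud–Evertse–Győry -/

/-- The `S`-part `[n]_S = ∏_{p ∈ S} p^{v_p(n)}` of a natural number. -/
def sPart (S : Finset ℕ) (n : ℕ) : ℕ := ∏ p ∈ S, p ^ n.factorization p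

/-- **BEG24Cubic** — Bugeaud–Evertse–Győry, *S-parts of values of univariate polynomials, binary forms and
decomposable forms at integral points*, Acta Arith. 184 (2018), Thm 2.4(i) with `n = 3` [arXiv:1708.08290, p. 3]:
for a binary cubic form `F ∈ ℤ[X,Y]` with `D(F) ≠ 0`, a finite prime set `S` and `ε > 0`,
`[F(x,y)]_S ≤ C(F,S,ε) · |F(x,y)|^{2/3+ε}` at all coprime `(x,y)` with `F(x,y) ≠ 0` (Mahler 1933 / Ridout;
`p`-adic Thue–Siegel–Roth, INEFFECTIVE in `C`; the exponent `2/3` is sharp by Thm 2.4(ii)).  Literature FACT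
(to be filed as a cite item), used as a hypothesis. -/
def BEG24Cubic : Prop :=
  ∀ (F : BinaryCubic ℤ), F.disc ≠ 0 → ∀ (S : Finset ℕ) (ε : ℝ), 0 < ε → ∃ C : ℝ,
    ∀ u v : ℤ, IsCoprime u v → F.eval u v ≠ 0 →
      (sPart S (F.eval u v).natAbs : ℝ) ≤ C * ((F.eval u v).natAbs : ℝ) ^ (2 / 3 + ε)

/-- **BEG25Cubic** — ibid. Thm 2.5 (EFFECTIVE; Győry–Yu): `[F(x,y)]_S ≤ κ₄ |F(x,y)|^{1−κ₃}` with
`κ₃ = (c₂^s (P·log p₁⋯log p_s)^d)^{-1}`, `d = [splitting field : ℚ] ∈ {3,6}`, `κ₄, c₂` effective in `F`.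
(A cubic form with `D(F) ≠ 0` has three pairwise non-proportional linear factors, as Thm 2.5 requires.) -/
def BEG25Cubic : Prop :=
  ∀ (F : BinaryCubic ℤ), F.disc ≠ 0 → ∀ (S : Finset ℕ), ∃ κ : ℝ, 0 < κ ∧ ∃ C : ℝ,
    ∀ u v : ℤ, IsCoprime u v → F.eval u v ≠ 0 →
      (sPart S (F.eval u v).natAbs : ℝ) ≤ C * ((F.eval u v).natAbs : ℝ) ^ (1 - κ)

/-- The index `[𝓞_K : ℤ[η]]` of the monogenic order generated by `η` (junk value `0` if `η ∈ ℤ`). -/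
noncomputable def orderIndex {K : Type} [Field K] [NumberField K] (η : 𝓞 K) : ℕ :=
  (Subalgebra.toSubmodule (Algebra.adjoin ℤ ({η} : Set (𝓞 K)))).toAddSubgroup.index

/-- `η` is PRIMITIVE in `𝓞_K / ℤ`: no prime `p` has `η ≡ a (mod p𝓞_K)` with `a ∈ ℤ`
(in Delone–Faddeev coordinates `η = a + uω + vθ`: `gcd(u,v) = 1`). -/
def IsPrimitiveElt {K : Type} [Field K] [NumberField K] (η : 𝓞 K) : Prop :=
  ∀ p : ℕ, p.Prime → ∀ a : ℤ, ¬ ((p : 𝓞 K) ∣ η - (a : 𝓞 K))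

/-- **BEG24Index K S** — Thm 2.4(i) in index language: for primitive `η ∈ 𝓞_K` (`K` cubic) and any
factorisation `ind(η) = s·m` with `s` `S`-smooth, `ind(η) ≤ C(K,S,ε) · m^{3+ε}`.
(`[F]_S ≤ C|F|^{2/3+ε}` ⇔ `|F| ≤ C' m^{3+ε'}` for `|F| = [F]_S · m`; and `ind(a+uω+vθ) = |F_K(u,v)|`.) -/
def BEG24Index (K : Type) [Field K] [NumberField K] (S : Finset ℕ) : Prop :=
  ∀ ε : ℝ, 0 < ε → ∃ C : ℝ, ∀ η : 𝓞 K, IsPrimitiveElt η → orderIndex η ≠ 0 →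
    ∀ s m : ℕ, orderIndex η = s * m → Smooth S s → (orderIndex η : ℝ) ≤ C * (m : ℝ) ^ (3 + ε)

/-- **H1 (M) — Delone–Faddeev transport.** `𝓞_K ≅ RingOfForm F_K` (tree:
`exists_ringOfForm_ringEquiv_ringOfIntegers`, `disc_eq_discr_of_ringEquiv_ringOfIntegers`), the index-form
identity `ind(a + uω + vθ) = |F_K(u,v)|` (Gaál 2019 §5.1; NOT yet in the tree: the one new lemma), `η` primitive
`⇔ gcd(u,v) = 1`,
and the exponent algebra `[F]_S ≤ C|F|^{2/3+ε} ⇒ |F| ≤ C^{3/(1-3ε)} m^{3/(1-3ε)}`. -/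
theorem beg24Index_of_cubic (h : BEG24Cubic) (K : Type) [Field K] [NumberField K]
    (h3 : Module.finrank ℚ K = 3) (S : Finset ℕ) : BEG24Index K S := by
  sorry

/-- **H2 (M) — the minimal 2-division order has bounded content.** For a class curve with global minimal
model `W₀`, `η := 4·x(T)` (root of `x³ + b₂x² + 8b₄x + 16b₆`, `disc = 2⁸Δ_min`) writes `η = a + g·η'` with
`η'` primitive and `ind(η) = g³·ind(η')`; minimality bounds `v_p(g)`: for `p ≥ 5`, `θ = p^k θ''` forces
`p^{2k} ∣ A, p^{3k} ∣ B` in short Weierstrass form, so `k ≤ 1`; at `p = 2, 3` the local Kraus conditions give an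
absolute bound. Hence `∃ Λ` (absolute) with `p^{Λ+1} ∤ g` for all `p`. -/
def MinimalOrderContent : Prop :=
  ∃ Λ : ℕ, ∀ (W : WeierstrassCurve ℚ) [W.IsElliptic] (K : Type) [Field K] [NumberField K], InClass W K →
    ∀ I : ℕ, 0 < I → 2 ^ 8 * W.minimalDiscriminantNorm ℤ = I ^ 2 * (NumberField.discr K).natAbs →
      ∃ (g : ℕ) (η : 𝓞 K), IsPrimitiveElt η ∧ I = g ^ 3 * orderIndex η ∧
        ∀ p : ℕ, p.Prime → ¬ p ^ (Λ + 1) ∣ g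

theorem minimalOrderContent : MinimalOrderContent := by
  sorry

/-- **IndexFreePartBound K S A** — the curve-level shape all rungs consume: for class-`K` curves, the
minimal-discriminant index satisfies `I ≤ C · m^A` for every factorisation `I = s·m` with `s` `S`-smooth
(equivalently: `I ≤ C·(S-free part of I)^A`).  Ridout: `A = 3 + ε` (ineffective); BEG Thm 2.5: `A = 1/κ₃`
(effective, huge). -/
def IndexFreePartBound (K : Type) [Field K] [NumberField K] (S : Finset ℕ) (A : ℝ) : Prop :=
  ∃ C : ℝ, ∀ (W : WeierstrassCurve ℚ) [W.IsElliptic], InClass W K →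
    ∀ I s m : ℕ, 2 ^ 8 * W.minimalDiscriminantNorm ℤ = I ^ 2 * (NumberField.discr K).natAbs →
      I = s * m → Smooth S s → (I : ℝ) ≤ C * (m : ℝ) ^ A

/-- **RidoutIndexBound K S** `:= ∀ ε > 0, IndexFreePartBound K S (3 + ε)`. -/
def RidoutIndexBound (K : Type) [Field K] [NumberField K] (S : Finset ℕ) : Prop :=
  ∀ ε : ℝ, 0 < ε → IndexFreePartBound K S (3 + ε)

/-- **H3 (S) — assembly of the analytic input.** From H1's output and H2: `I = g³·ind(η')`,
`ind(η') ≤ C m'^{3+ε}`, `[g]_S ≤ ∏_{p∈S} p^Λ`, and `g_free³·m' ≤ m` give `I ≤ (∏_{p∈S}p^Λ)³·C·m^{3+ε}`. -/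
theorem ridoutIndexBound_of (K : Type) [Field K] [NumberField K]
    (h1 : ∀ S : Finset ℕ, BEG24Index K S) (h2 : MinimalOrderContent) (S : Finset ℕ) :
    RidoutIndexBound K S := by
  sorry

/-! ## §3 The free part on the family `F_B(K,S)` (PROVED) -/

/-- `InFamily S B W`: free-prime depth at most `B` — `v_p(Δ_min) ≤ 2B` for every prime `p ∉ S`
(towers of ARBITRARY height at the primes of `S`).  `F₁ ⊋ F₀ :=` Shafarevich's `{N supported on S}`. -/
def InFamily (S : Finset ℕ) (B : ℕ) (W : WeierstrassCurve ℚ) : Prop :=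
  ∀ p : ℕ, p.Prime → p ∉ S → (W.minimalDiscriminantNorm ℤ).factorization p ≤ 2 * B

/-- **H4 (PROVED).** On `F_B(K,S)` with `2 ∈ S`: `I = s·m` with `s` `S`-smooth and `m ∣ N^B`
(`p ∣ m ⇒ p ∣ Δ_min ⇒ p ∣ N` by `primeFactors_minimalDiscriminantNorm`; `2v_p(I) ≤ v_p(Δ_min) ≤ 2B`). -/
theorem exists_smooth_mul_dvd_conductor_pow (S : Finset ℕ) (h2S : 2 ∈ S) (B : ℕ)
    (W : WeierstrassCurve ℚ) [W.IsElliptic] (K : Type) [Field K] [NumberField K]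
    (hfam : InFamily S B W) {I : ℕ} (hI : 0 < I)
    (hid : 2 ^ 8 * W.minimalDiscriminantNorm ℤ = I ^ 2 * (NumberField.discr K).natAbs) :
    ∃ s m : ℕ, I = s * m ∧ Smooth S s ∧ 0 < m ∧ m ∣ W.conductorNorm ℤ ^ B := by
  classical
  set T := I.primeFactors.filter (fun p => p ∉ S) with hT
  have hΔ0 : 0 < W.minimalDiscriminantNorm ℤ := W.minimalDiscriminantNorm_pos_holds
  have hN0 : 0 < W.conductorNorm ℤ := W.conductorNorm_pos_holds
  have hD0 : (NumberField.discr K).natAbs ≠ 0 := Int.natAbs_ne_zero.mpr (NumberField.discr_ne_zero K)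
  -- the key local facts at a free prime of `I`
  have key : ∀ p ∈ T, I.factorization p ≤ B ∧ p ∈ (W.conductorNorm ℤ).primeFactors := by
    intro p hp
    rw [hT, Finset.mem_filter] at hp
    obtain ⟨hpI, hpS⟩ := hp
    have hp : p.Prime := Nat.prime_of_mem_primeFactors hpI
    have hpdI : p ∣ I := Nat.dvd_of_mem_primeFactors hpI
    have hp2 : p ≠ 2 := fun h => hpS (h ▸ h2S)
    -- valuation bookkeeping in `2⁸ Δ = I² D`
    have hv : (2 ^ 8 * W.minimalDiscriminantNorm ℤ).factorization p =
        (I ^ 2 * (NumberField.discr K).natAbs).factorization p := by rw [hid]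
    rw [Nat.factorization_mul (by norm_num) hΔ0.ne', Nat.factorization_mul (pow_ne_zero _ hI.ne') hD0,
      Finsupp.add_apply, Finsupp.add_apply, Nat.factorization_pow 2 8, Nat.factorization_pow I 2,
      Finsupp.smul_apply, Finsupp.smul_apply, smul_eq_mul, smul_eq_mul,
      Nat.Prime.factorization Nat.prime_two, Finsupp.single_apply, if_neg (fun h => hp2 h.symm)] at hv
    have hvI : 0 < I.factorization p := hp.factorization_pos_of_dvd hI.ne' hpdI
    have hfamp := hfam p hp hpS
    refine ⟨by omega, ?_⟩
    have hvΔ : (W.minimalDiscriminantNorm ℤ).factorization p ≠ 0 := by omega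
    have hpΔ : p ∣ W.minimalDiscriminantNorm ℤ := Nat.dvd_of_factorization_pos hvΔ
    rw [← W.primeFactors_minimalDiscriminantNorm]
    exact Nat.mem_primeFactors.mpr ⟨hp, hpΔ, hΔ0.ne'⟩
  refine ⟨∏ p ∈ I.primeFactors.filter (fun p => p ∈ S), p ^ I.factorization p,
    ∏ p ∈ T, p ^ I.factorization p, ?_, ?_, ?_, ?_⟩
  · -- `I = s * m`
    have h := Nat.prod_factorization_pow_eq_self hI.ne'
    rw [Finsupp.prod, Nat.support_factorization] at h
    rw [hT, Finset.prod_filter_mul_prod_filter_not, h]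
  · -- `s` is `S`-smooth
    intro p hp hdvd
    obtain ⟨q, hq, hpq⟩ := (Prime.dvd_finsetProd_iff hp.prime _).mp hdvd
    rw [Finset.mem_filter] at hq
    have hqp : q.Prime := Nat.prime_of_mem_primeFactors hq.1
    have hpq' : p = q := (Nat.prime_dvd_prime_iff_eq hp hqp).mp (hp.dvd_of_dvd_pow hpq)
    exact hpq' ▸ hq.2
  · -- `0 < m`
    exact Finset.prod_pos fun p hp =>
      pow_pos (Nat.prime_of_mem_primeFactors (Finset.mem_filter.mp hp).1).pos _
  · -- `m ∣ N ^ B`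
    have h1 : ∏ p ∈ T, p ^ I.factorization p ∣ ∏ p ∈ T, p ^ B :=
      Finset.prod_dvd_prod_of_dvd _ _ fun p hp => pow_dvd_pow p (key p hp).1
    have h2 : ∏ p ∈ T, p ∣ ∏ p ∈ (W.conductorNorm ℤ).primeFactors, p :=
      Finset.prod_dvd_prod_of_subset _ _ _ fun p hp => (key p hp).2
    have h3 : ∏ p ∈ (W.conductorNorm ℤ).primeFactors, p ∣ W.conductorNorm ℤ :=
      Nat.prod_primeFactors_dvd _
    rw [Finset.prod_pow] at h1
    exact h1.trans (pow_dvd_pow_of_dvd (h2.trans h3) B)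

/-! ## §4 The rungs (PROVED from §1–§3) -/

/-- **Core bound (PROVED)** — one curve: `2⁸Δ = I²|d_K|`, `I ≤ C₁ m^A`, `m ∣ N^B` give
`Δ_min ≤ C₁² · |d_K| · N^{2AB}`. -/
theorem core_bound (W : WeierstrassCurve ℚ) [W.IsElliptic] (K : Type) [Field K] [NumberField K]
    {I m : ℕ} (hid : 2 ^ 8 * W.minimalDiscriminantNorm ℤ = I ^ 2 * (NumberField.discr K).natAbs)
    {C₁ A : ℝ} (hC₁ : 0 ≤ C₁) (hA : 0 ≤ A) (hIle : (I : ℝ) ≤ C₁ * (m : ℝ) ^ A)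
    {B : ℕ} (hmN : m ∣ W.conductorNorm ℤ ^ B) :
    (W.minimalDiscriminantNorm ℤ : ℝ) ≤
      C₁ ^ 2 * |(NumberField.discr K : ℝ)| * (W.conductorNorm ℤ : ℝ) ^ (2 * A * B) := by
  set N := W.conductorNorm ℤ with hN
  have hNpos : 0 < N := W.conductorNorm_pos_holds
  have hN0 : (0 : ℝ) ≤ (N : ℝ) := Nat.cast_nonneg N
  have hm0 : (0 : ℝ) ≤ (m : ℝ) := Nat.cast_nonneg m
  -- `m ≤ N ^ B`
  have hmle : (m : ℝ) ≤ (N : ℝ) ^ (B : ℝ) := by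
    have : m ≤ N ^ B := Nat.le_of_dvd (pow_pos hNpos B) hmN
    rw [Real.rpow_natCast]
    exact_mod_cast this
  have hmA : (m : ℝ) ^ A ≤ (N : ℝ) ^ ((B : ℝ) * A) := by
    rw [Real.rpow_mul hN0]
    exact Real.rpow_le_rpow hm0 hmle hA
  have hI' : (I : ℝ) ≤ C₁ * (N : ℝ) ^ ((B : ℝ) * A) :=
    hIle.trans (mul_le_mul_of_nonneg_left hmA hC₁)
  -- square it
  have h0I : (0 : ℝ) ≤ (I : ℝ) := Nat.cast_nonneg I
  have hI2 : (I : ℝ) ^ 2 ≤ C₁ ^ 2 * (N : ℝ) ^ (2 * A * B) := by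
    have h := pow_le_pow_left₀ h0I hI' 2
    have hexp : (C₁ * (N : ℝ) ^ ((B : ℝ) * A)) ^ 2 = C₁ ^ 2 * (N : ℝ) ^ (2 * A * B) := by
      rw [mul_pow, ← Real.rpow_natCast ((N : ℝ) ^ ((B : ℝ) * A)) 2, ← Real.rpow_mul hN0]
      congr 1
      push_cast
      ring_nf
    rw [hexp] at h
    exact h
  -- the keystone identity in `ℝ`
  have hDabs : (((NumberField.discr K).natAbs : ℕ) : ℝ) = |(NumberField.discr K : ℝ)| := by
    rw [← Int.cast_natCast (R := ℝ), Int.natCast_natAbs, Int.cast_abs]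
  have hidR : (256 : ℝ) * (W.minimalDiscriminantNorm ℤ : ℝ) =
      (I : ℝ) ^ 2 * |(NumberField.discr K : ℝ)| := by
    have h := congrArg (fun n : ℕ => (n : ℝ)) hid
    simp only [Nat.cast_mul, Nat.cast_pow, Nat.cast_ofNat] at h
    rw [hDabs] at h
    linarith [h]
  have hΔ0 : (0 : ℝ) ≤ (W.minimalDiscriminantNorm ℤ : ℝ) := Nat.cast_nonneg _
  calc (W.minimalDiscriminantNorm ℤ : ℝ)
      ≤ 256 * (W.minimalDiscriminantNorm ℤ : ℝ) := by linarith
    _ = (I : ℝ) ^ 2 * |(NumberField.discr K : ℝ)| := hidR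
    _ ≤ (C₁ ^ 2 * (N : ℝ) ^ (2 * A * B)) * |(NumberField.discr K : ℝ)| :=
        mul_le_mul_of_nonneg_right hI2 (abs_nonneg _)
    _ = C₁ ^ 2 * |(NumberField.discr K : ℝ)| * (N : ℝ) ^ (2 * A * B) := by ring

/-- **R_A,B (PROVED)** — the general rung: `Keystone`, an index/free-part bound with exponent `A` for the
field `K` at `S ∋ 2`, free depth `≤ B` ⟹ `Δ_min ≤ C(K,S,A)·|d_K|·N^{2AB}` on `F_B(K,S)`.
With BEG Thm 2.5 (`A = 1/κ₃`, effective) this is an EFFECTIVE polynomial Szpiro bound on `F_B(K,S)`. -/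
theorem rung_of_indexFreePartBound (hK5 : Keystone) (K : Type) [Field K] [NumberField K]
    (S : Finset ℕ) (h2S : 2 ∈ S) {A : ℝ} (hA : 0 ≤ A) (hR : IndexFreePartBound K S A) (B : ℕ) :
    ∃ C : ℝ, ∀ (W : WeierstrassCurve ℚ) [W.IsElliptic], InClass W K → InFamily S B W →
      (W.minimalDiscriminantNorm ℤ : ℝ) ≤
        C * |(NumberField.discr K : ℝ)| * (W.conductorNorm ℤ : ℝ) ^ (2 * A * B) := by
  obtain ⟨C₁, hC₁⟩ := hR
  refine ⟨max C₁ 0 ^ 2, fun W _ hcl hfam => ?_⟩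
  obtain ⟨I, hI0, hid⟩ := hK5 W K hcl
  obtain ⟨s, m, hsm, hs, hm0, hmN⟩ := exists_smooth_mul_dvd_conductor_pow S h2S B W K hfam hI0 hid
  have hIle : (I : ℝ) ≤ max C₁ 0 * (m : ℝ) ^ A :=
    (hC₁ W hcl I s m hid hsm hs).trans
      (mul_le_mul_of_nonneg_right (le_max_left _ _) (Real.rpow_nonneg (Nat.cast_nonneg m) A))
  exact core_bound W K hid (le_max_right _ _) hA hIle hmN

/-- **R_B (PROVED) — the Mahler–Ridout rung on `F_B(K,S)`:** `Δ_min ≤ C(K,S,ε)·|d_K|·N^{B(6+ε)}`. -/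
theorem ridoutRung (hK5 : Keystone) (K : Type) [Field K] [NumberField K]
    (S : Finset ℕ) (h2S : 2 ∈ S) (hR : RidoutIndexBound K S) (B : ℕ) :
    ∀ ε : ℝ, 0 < ε → ∃ C : ℝ, ∀ (W : WeierstrassCurve ℚ) [W.IsElliptic], InClass W K → InFamily S B W →
      (W.minimalDiscriminantNorm ℤ : ℝ) ≤
        C * |(NumberField.discr K : ℝ)| * (W.conductorNorm ℤ : ℝ) ^ ((B : ℝ) * (6 + ε)) := by
  intro ε hε
  obtain ⟨C, hC⟩ :=
    rung_of_indexFreePartBound hK5 K S h2S (A := 3 + ε / 2) (by positivity) (hR (ε / 2) (by positivity)) B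
  refine ⟨C, fun W _ hcl hfam => ?_⟩
  have h := hC W hcl hfam
  have he : (2 * (3 + ε / 2) * (B : ℝ) : ℝ) = (B : ℝ) * (6 + ε) := by ring
  rwa [he] at h

/-- **R₁ (PROVED) — the STUB'S OWN INEQUALITY, exponent `6 + ε`, on the infinite family `F₁(K,S)`**
(each fixed cubic `K`, each finite `S ∋ 2`; `C = C(K,S,ε)` ineffective).  This is `StubRealCubic` with
(i) `K, S` quantified BEFORE `∃ C` and (ii) `W` restricted to free depth `1`; nothing else changed. -/
theorem ridoutRung_one (hK5 : Keystone) (K : Type) [Field K] [NumberField K]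
    (S : Finset ℕ) (h2S : 2 ∈ S) (hR : RidoutIndexBound K S) :
    ∀ ε : ℝ, 0 < ε → ∃ C : ℝ, ∀ (W : WeierstrassCurve ℚ) [W.IsElliptic], InClass W K → InFamily S 1 W →
      (W.minimalDiscriminantNorm ℤ : ℝ) ≤
        C * |(NumberField.discr K : ℝ)| * (W.conductorNorm ℤ : ℝ) ^ (6 + ε) := by
  intro ε hε
  obtain ⟨C, hC⟩ := ridoutRung hK5 K S h2S hR 1 ε hε
  refine ⟨C, fun W _ hcl hfam => ?_⟩
  have h := hC W hcl hfam
  have he : (((1 : ℕ) : ℝ) * (6 + ε) : ℝ) = 6 + ε := by push_cast; ring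
  rwa [he] at h

/-- **The unconditional form of R₁** (modulo the helper bodies H1–H3): BEG Thm 2.4(i) ⟹ the stub's
inequality on every `F₁(K,S)`, `K` cubic, `2 ∈ S`. -/
theorem ridoutRung_one_of_BEG (hK5 : Keystone) (hBEG : BEG24Cubic) (K : Type) [Field K] [NumberField K]
    (h3 : Module.finrank ℚ K = 3) (S : Finset ℕ) (h2S : 2 ∈ S) :
    ∀ ε : ℝ, 0 < ε → ∃ C : ℝ, ∀ (W : WeierstrassCurve ℚ) [W.IsElliptic], InClass W K → InFamily S 1 W →
      (W.minimalDiscriminantNorm ℤ : ℝ) ≤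
        C * |(NumberField.discr K : ℝ)| * (W.conductorNorm ℤ : ℝ) ^ (6 + ε) :=
  ridoutRung_one hK5 K S h2S
    (ridoutIndexBound_of K (fun S' => beg24Index_of_cubic hBEG K h3 S') minimalOrderContent S)

/-! ## §5 What separates R₁ from the stub: (U) uniformity in `K` (typed), (T) free depth `≥ 2` -/

/-- **(U) UniformRidoutIndexBound** — the Ridout index bound with `S = S₀(K) :=` primes of `6·d_K` and a
constant INDEPENDENT of `K`.  OPEN; abc-strength (uniform `p`-adic Roth for cubic irrationalities with
polynomial dependence on the height; only the NUMBER of exceptional approximations is known to be uniform —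
Davenport–Roth, Bombieri–van der Poorten, Evertse).  Not a Literature fact; a candidate route item if wanted. -/
def UniformRidoutIndexBound : Prop :=
  ∀ ε : ℝ, 0 < ε → ∃ C : ℝ, ∀ (K : Type) [Field K] [NumberField K] (W : WeierstrassCurve ℚ) [W.IsElliptic],
    InClass W K → ∀ I s m : ℕ, 2 ^ 8 * W.minimalDiscriminantNorm ℤ = I ^ 2 * (NumberField.discr K).natAbs →
      I = s * m → Smooth (6 * (NumberField.discr K).natAbs).primeFactors s → (I : ℝ) ≤ C * (m : ℝ) ^ (3 + ε)

/-- **(U) ⟹ the stub on the whole depth-1 locus `⋃_K F₁(K, S₀(K))` (PROVED)** — uniform in `K`, both signs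
of `d_K`.  The complement (free depth `≥ 2`) is where Ridout yields only `6B + ε` and the `Mp`/Thue–Mahler
statements of k2 / gen 5 live; the stub is not the conjunction of the two (see the file docstring). -/
theorem stub_on_depthOne_of_uniform (hK5 : Keystone) (hU : UniformRidoutIndexBound) :
    ∀ ε : ℝ, 0 < ε → ∃ C : ℝ, ∀ (W : WeierstrassCurve ℚ) [W.IsElliptic] (K : Type) [Field K] [NumberField K],
      InClass W K → InFamily (6 * (NumberField.discr K).natAbs).primeFactors 1 W →
      (W.minimalDiscriminantNorm ℤ : ℝ) ≤
        C * |(NumberField.discr K : ℝ)| * (W.conductorNorm ℤ : ℝ) ^ (6 + ε) := by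
  intro ε hε
  obtain ⟨C₁, hC₁⟩ := hU (ε / 2) (by positivity)
  refine ⟨max C₁ 0 ^ 2, fun W _ K _ _ hcl hfam => ?_⟩
  obtain ⟨I, hI0, hid⟩ := hK5 W K hcl
  have h2S : 2 ∈ (6 * (NumberField.discr K).natAbs).primeFactors := by
    have hD0 : (NumberField.discr K).natAbs ≠ 0 := Int.natAbs_ne_zero.mpr (NumberField.discr_ne_zero K)
    exact Nat.mem_primeFactors.mpr ⟨Nat.prime_two, dvd_mul_of_dvd_left (by norm_num) _, by positivity⟩
  obtain ⟨s, m, hsm, hs, hm0, hmN⟩ :=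
    exists_smooth_mul_dvd_conductor_pow _ h2S 1 W K hfam hI0 hid
  have hIle : (I : ℝ) ≤ max C₁ 0 * (m : ℝ) ^ (3 + ε / 2) :=
    (hC₁ K W hcl I s m hid hsm hs).trans
      (mul_le_mul_of_nonneg_right (le_max_left _ _) (Real.rpow_nonneg (Nat.cast_nonneg m) _))
  have h := core_bound W K hid (le_max_right _ _) (by positivity) hIle hmN
  have he : (2 * (3 + ε / 2) * ((1 : ℕ) : ℝ) : ℝ) = 6 + ε := by push_cast; ring
  rwa [he] at h

/-! ## §6 Ladder added by gen 6 (all arrows kernel-checked except the helper bodies H1–H3):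

`F₀(K,S)` (bad primes `⊆ S`; finite — Shafarevich, k1)  ⊂  `F₁(K,S)` (free depth 1; infinite; **stub inequality
holds, exponent 6+ε, R₁**)  ⊂  `F_B(K,S)` (**PolySzpiro(6B+ε)**, R_B; effective `2B/κ₃` via Thm 2.5)  ⊂  class(K)
(= stub for one `K`: open)  ⊂  real class (stub: open = (U) on depth 1 + (T) beyond). -/

end Summit.ABC.ABC.Cruxes.IndexSzpiro.StubIdeas3G6
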